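import Mathlib
import Summits.HodgeConjecture.FermatCycles.HodgeFermatTheoremD6A

/-!
# THEOREM D6 — the assembly, modulo PROPOSITION L7(c) and THEOREM U — part 2: `theoremD6_of` (`HodgeFermat/TheoremD6.lean`; HF-G21g)

Tree copy (part 2 of 2) of the module `HodgeFermat/TheoremD6.lean` of the sibling cell's standalone package
`run/shared/lean/pub/pub-hodgefermat/lean/HodgeFermat/` (564 lines, sha256 `acde7c49261755f7…`), source lines 288–564 (§§4–7: the small levels at 5, `noZ3`, the eliminations at primes ≥ 7 and at 5, `d6_primitive`, `theoremD6_of`).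
Filed by cell `pub-hfermat`, seat prover-1 gen-3, on the COORDINATOR KEEPER RULING of 2026-08-25 (gem sweep H1: take the
off-gate kernel theorem `thmFstar` through the gate) — here THEOREM F* of `tables/DPRIME-THEOREM.md` §9 IN FULL, i.e.
PROPOSITION D′(3N) and the descent (`HodgeFermat/PropDPrimeNFinal.lean`, GATE HF-G34), the last off-gate form of THEOREM F*
(its first two forms, `DecodingFinal.thmFstar` = F* at the prime levels and `ThmFstarNFinal.thmFstar` = F*(3N), landed on
2026-08-25 as `HodgeFermatThmFstar.lean` / `HodgeFermatThmFstarN.lean`, seats prover-1 gen-0 / gen-2); this file is one link of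
the import closure of `PropDPrimeNFinal.propDprime` (the sibling's KR-free chain: THEOREM L, COROLLARY M, THEOREM D6,
THEOREM U⁺, THEOREM KR6, THEOREM Z3U) on top of those landed chains.  The source module is the sibling's hub-checked module of
record (pub-hodgefermat `CERT.md` l.882, GATE HF-G21g; cell record `check/TheoremD6_standalone.lean` sha256 `e3481f23a610a68e…`); its declarations are copied VERBATIM.
Deviations from the source module, exhaustively: the `import` lines (tree modules `Summits.HodgeConjecture.FermatCycles.
HodgeFermat*` instead of `HodgeFermat.*`); this module docstring; the `set_option`/namespace/`open` preamble (source l.56–61) and part 1's three re-binding `open` lines are repeated at the top because the module is split; one-line docstrings added (gate lint) to `coprime30`. The module docstring is quoted in full in part 1.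
Every other line — in particular every declaration's statement and proof — is byte-identical to the source.
HONEST FRAMING: explicit algebraic cycles for specific Hodge classes on Fermat/Delsarte varieties; residual open instances
listed; no claim on general Hodge.  (This file is arithmetic of CM types / finite combinatorics / analytic number theory
of the sibling's KR-free programme; it claims nothing about cycles.)
-/

set_option autoImplicit false

namespace HodgeFermat.KRFree.TheoremD6

open HodgeFermat.KRFree HodgeFermat.KRFree.LemmaN HodgeFermat.KRFree.LemmaO HodgeFermat.KRFree.TheoremL
  HodgeFermat.KRFree.Bridge
open HodgeFermat.KRFree.Decoding renaming st_symm → sameType_symm, st_trans → sameType_trans, st_swap → sameType_swap, st_rot → sameType_rot, unit_mul_not_dvd → not_dvd_unit_mul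
open HodgeFermat.KRFree.Decoding (rsum_swap rsum_rot)
open HodgeFermat.KRFree.TheoremZ3U renaming not_dvd_cofactor' → not_dvd_cofactor, rsum_const₃ → rsum_const_of_dvd

/-! ## STEP A: no prime of the level divides a whole triple (pattern Z3) -/

/-- rows (Z3,U) and (Z3,Z1) at the prime 5 when `3 ∤ N'` (cf. `z3_vs_any` for primes `≥ 7`) -/
theorem z3_vs_any5 (N' a b c u v w : ℕ) (h5N : ¬ 5 ∣ N') (hN : 0 < N') (hodd : Odd N') (h3 : ¬ 3 ∣ N')
    (hs : 5 * N' ∣ u + v + w) (hne : ¬ (5 ∣ u ∧ 5 ∣ v ∧ 5 ∣ w))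
    (hu : ¬ 5 * N' ∣ u) (hv : ¬ 5 * N' ∣ v) (hw : ¬ 5 * N' ∣ w)
    (hH : SameType (5 * N') (5 * a, 5 * b, 5 * c) (u, v, w)) : False := by
  have hN0 : 0 < 5 * N' := by omega
  have h5 : (5 : ℕ) ∣ 5 * N' := dvd_mul_right 5 N'
  by_cases hqu : 5 ∣ u
  · by_cases hqv : 5 ∣ v
    · exact hne ⟨hqu, hqv, dvd_third h5 hs hqu hqv⟩
    · by_cases hqw : 5 ∣ w
      · exact hqv (dvd_second h5 hs hqu hqw)
      · obtain ⟨y₀, rfl⟩ := hqu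
        have hy₀ : ¬ N' ∣ y₀ := fun h => hu (Nat.mul_dvd_mul_left 5 h)
        exact row_Z3Z1_five_not3 N' a b c y₀ v w h5N hN hodd h3 hs hqv hqw hy₀ hH
  · by_cases hqv : 5 ∣ v
    · by_cases hqw : 5 ∣ w
      · exact hqu (dvd_first h5 hs hqv hqw)
      · obtain ⟨y₀, rfl⟩ := hqv
        have hy₀ : ¬ N' ∣ y₀ := fun h => hv (Nat.mul_dvd_mul_left 5 h)
        have hH' : SameType (5 * N') (5 * a, 5 * b, 5 * c) (5 * y₀, u, w) :=
          sameType_trans hH (sameType_swap hN0 hs hw)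
        have hs2 : 5 * N' ∣ 5 * y₀ + u + w := by rwa [show 5 * y₀ + u + w = u + 5 * y₀ + w by ring]
        exact row_Z3Z1_five_not3 N' a b c y₀ u w h5N hN hodd h3 hs2 hqu hqw hy₀ hH'
    · by_cases hqw : 5 ∣ w
      · obtain ⟨y₀, rfl⟩ := hqw
        have hy₀ : ¬ N' ∣ y₀ := fun h => hw (Nat.mul_dvd_mul_left 5 h)
        have hH' : SameType (5 * N') (5 * a, 5 * b, 5 * c) (5 * y₀, u, v) :=
          sameType_trans hH (sameType_rot hN0 hs hv hw)
        have hs2 : 5 * N' ∣ 5 * y₀ + u + v := by rwa [show 5 * y₀ + u + v = u + v + 5 * y₀ by ring]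
        exact row_Z3Z1_five_not3 N' a b c y₀ u v h5N hN hodd h3 hs2 hqu hqv hy₀ hH'
      · exact row_Z3U 5 N' a b c u v w Nat.prime_five (le_refl 5) h5N hN hs hqu hqv hqw hH

/-- STEP A: in the setting no prime of `N` divides all three entries of the first triple -/
lemma noZ3 {N a b c a' b' c' : ℕ} (S : Setting N (a, b, c) (a', b', c')) {q : ℕ} (hq : q.Prime)
    (hqN : q ∣ N) (ha : q ∣ a) (hb : q ∣ b) (hc : q ∣ c) : False := by
  have hodd := S.odd
  have h3N := S.three
  obtain ⟨n, rfl⟩ := hqN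
  have hn0 : 0 < n := pos_right S.pos
  have hqn : ¬ q ∣ n := not_dvd_cofactor hq S.sq
  have hoddn : Odd n := (Nat.odd_mul.mp hodd).2
  have h3n : ¬ 3 ∣ n := fun h => h3N (Dvd.dvd.mul_left h q)
  have hne : ¬ (q ∣ a' ∧ q ∣ b' ∧ q ∣ c') :=
    fun h => S.jp q hq (dvd_mul_right q n) ha hb hc h.1 h.2.1 h.2.2
  obtain ⟨a₁, rfl⟩ := ha
  obtain ⟨b₁, rfl⟩ := hb
  obtain ⟨c₁, rfl⟩ := hc
  by_cases h7 : 7 ≤ q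
  · exact z3_vs_any q n a₁ b₁ c₁ a' b' c' hq h7 hqn hn0 hoddn S.hsum' hne S.nz₁' S.nz₂' S.nz₃' S.same
  · have hq5 : q = 5 := by
      by_contra h5
      exact h7 (seven_le_prime hq (dvd_mul_right q n) hodd h3N h5)
    subst hq5
    exact z3_vs_any5 n a₁ b₁ c₁ a' b' c' hqn hn0 hoddn h3n S.hsum' hne S.nz₁' S.nz₂' S.nz₃' S.same

/-! ## STEP B: the rows at a prime `q ≥ 7` dividing exactly one entry of the first triple -/

/-- (Z1, U) at a prime `q ≥ 7`: `row_UZ1_ge_eleven_not3` (`q ≥ 11`), `row_UZ1_seven_not3` (`q = 7`) -/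
lemma no_UZ1_ge7 {N a b c a' b' c' : ℕ} (S : Setting N (a, b, c) (a', b', c')) {q : ℕ} (hq : q.Prime)
    (h7 : 7 ≤ q) (hqN : q ∣ N) (ha : q ∣ a) (hb : ¬ q ∣ b) (hc : ¬ q ∣ c)
    (ha' : ¬ q ∣ a') (hb' : ¬ q ∣ b') (hc' : ¬ q ∣ c') : False := by
  have hodd := S.odd
  have h3N := S.three
  have hjp := S.jp
  obtain ⟨n, rfl⟩ := hqN
  have hn0 : 0 < n := pos_right S.pos
  have hqn : ¬ q ∣ n := not_dvd_cofactor hq S.sq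
  have hoddn : Odd n := (Nat.odd_mul.mp hodd).2
  have h3n : ¬ 3 ∣ n := fun h => h3N (Dvd.dvd.mul_left h q)
  have hsqn : Squarefree n := Squarefree.squarefree_of_dvd (dvd_mul_left n q) S.sq
  obtain ⟨y, rfl⟩ := ha
  have hy : ¬ n ∣ y := fun h => S.nz₁ (Nat.mul_dvd_mul_left q h)
  by_cases h11 : 11 ≤ q
  · exact row_UZ1_ge_eleven_not3 q n y b c a' b' c' hq h11 hqn hn0 hoddn h3n S.hsum hb hc S.hsum'
      ha' hb' hc' hy S.same
  · have hq7 : q = 7 := by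
      have hlt : q < 11 := by omega
      interval_cases q
      · rfl
      · exact absurd hq (by norm_num)
      · exact absurd hq (by norm_num)
      · exact absurd hq (by norm_num)
    subst hq7
    exact row_UZ1_seven_not3 n y b c a' b' c' hsqn hqn h3n hn0 hoddn S.hsum hb hc S.hsum' ha' hb' hc'
      hy (gcd_chain_eq_one hjp) S.same

/-- (Z1, Z1) at a prime `q ≥ 7`: `row_Z1Z1_eleven` (`q ≥ 11`, `ȳ ≠ ȳ'` by disjointness), `PropL7c` (`q = 7`) -/
lemma no_Z1Z1_ge7 (hL : PropL7c) {N a b c a' b' c' : ℕ} (S : Setting N (a, b, c) (a', b', c')) {q : ℕ}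
    (hq : q.Prime) (h7 : 7 ≤ q) (hqN : q ∣ N) (ha : q ∣ a) (hb : ¬ q ∣ b) (hc : ¬ q ∣ c)
    (ha' : q ∣ a') (hb' : ¬ q ∣ b') (hc' : ¬ q ∣ c') : False := by
  have hodd := S.odd
  have h3N := S.three
  obtain ⟨n, rfl⟩ := hqN
  have hn0 : 0 < n := pos_right S.pos
  have hqn : ¬ q ∣ n := not_dvd_cofactor hq S.sq
  have hoddn : Odd n := (Nat.odd_mul.mp hodd).2
  have h3n : ¬ 3 ∣ n := fun h => h3N (Dvd.dvd.mul_left h q)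
  have hsqn : Squarefree n := Squarefree.squarefree_of_dvd (dvd_mul_left n q) S.sq
  obtain ⟨y, rfl⟩ := ha
  obtain ⟨y', rfl⟩ := ha'
  have hy : ¬ n ∣ y := fun h => S.nz₁ (Nat.mul_dvd_mul_left q h)
  have hy' : ¬ n ∣ y' := fun h => S.nz₁' (Nat.mul_dvd_mul_left q h)
  by_cases h11 : 11 ≤ q
  · have hyy' : ¬ y ≡ y' [MOD n] := fun e => S.disj.1.1 (Nat.ModEq.mul_left' q e)
    exact row_Z1Z1_eleven q n y b c y' b' c' hq h11 hqn hn0 hoddn S.hsum hb hc S.hsum' hb' hc' hyy' S.same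
  · have hq7 : q = 7 := by
      have hlt : q < 11 := by omega
      interval_cases q
      · rfl
      · exact absurd hq (by norm_num)
      · exact absurd hq (by norm_num)
      · exact absurd hq (by norm_num)
    subst hq7
    exact hL n y b c y' b' c' hsqn hqn h3n hoddn S.hsum hb hc hy S.hsum' hb' hc' hy' S.jp S.disj S.same

/-- STEP B: no prime `q ≥ 7` of the level divides an entry (here: the first entry of the first triple) -/
lemma elim_ge7 (hL : PropL7c) {N a b c a' b' c' : ℕ} (S : Setting N (a, b, c) (a', b', c')) {q : ℕ}
    (hq : q.Prime) (h7 : 7 ≤ q) (hqN : q ∣ N) (ha : q ∣ a) : False := by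
  have hb : ¬ q ∣ b := fun hb => noZ3 S hq hqN ha hb (dvd_third hqN S.hsum ha hb)
  have hc : ¬ q ∣ c := fun hc => noZ3 S hq hqN ha (dvd_second hqN S.hsum ha hc) hc
  by_cases ha' : q ∣ a'
  · have hb' : ¬ q ∣ b' := fun h => noZ3 S.symm hq hqN ha' h (dvd_third hqN S.hsum' ha' h)
    have hc' : ¬ q ∣ c' := fun h => noZ3 S.symm hq hqN ha' (dvd_second hqN S.hsum' ha' h) h
    exact no_Z1Z1_ge7 hL S hq h7 hqN ha hb hc ha' hb' hc'
  · by_cases hb' : q ∣ b'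
    · have hc' : ¬ q ∣ c' := fun h => ha' (dvd_first hqN S.hsum' hb' h)
      exact no_Z1Z1_ge7 hL S.swap12' hq h7 hqN ha hb hc hb' ha' hc'
    · by_cases hc' : q ∣ c'
      · exact no_Z1Z1_ge7 hL S.rot' hq h7 hqN ha hb hc hc' ha' hb'
      · exact no_UZ1_ge7 S hq h7 hqN ha hb hc ha' hb' hc'

/-- hence every entry is prime to the part of the level that is prime to 5 -/
lemma coprime_of (hL : PropL7c) {N a b c a' b' c' : ℕ} (S : Setting N (a, b, c) (a', b', c')) {n : ℕ}
    (hn : n ∣ N) (h5 : ¬ 5 ∣ n) : Nat.Coprime a n := by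
  by_contra hco
  obtain ⟨r, hr, hra, hrn⟩ := Nat.Prime.not_coprime_iff_dvd.mp hco
  have hrN : r ∣ N := dvd_trans hrn hn
  have hr5 : r ≠ 5 := fun h => h5 (h ▸ hrn)
  exact elim_ge7 hL S hr (seven_le_prime hr hrN S.odd S.three hr5) hrN hra

/-! ## STEP C: the prime 5 — PROPOSITIONS L5 and Z5 -/

/-- a number prime to 2, 3 and 5 is prime to 30 -/
lemma coprime30 {n : ℕ} (h2 : ¬ 2 ∣ n) (h3 : ¬ 3 ∣ n) (h5 : ¬ 5 ∣ n) : Nat.Coprime n 30 := by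
  have c2 : Nat.Coprime n 2 := ((Nat.Prime.coprime_iff_not_dvd Nat.prime_two).mpr h2).symm
  have c3 : Nat.Coprime n 3 := ((Nat.Prime.coprime_iff_not_dvd Nat.prime_three).mpr h3).symm
  have c5 : Nat.Coprime n 5 := ((Nat.Prime.coprime_iff_not_dvd Nat.prime_five).mpr h5).symm
  rw [show (30 : ℕ) = 2 * (3 * 5) by norm_num]
  exact Nat.Coprime.mul_right c2 (Nat.Coprime.mul_right c3 c5)

/-- STEP C: the prime 5 does not divide an entry (here: the first entry of the first triple) —
(Z1, U) at 5 is PROPOSITION L5, (Z1, Z1) at 5 is PROPOSITION Z5 (levels `≤ 100`: the facts F5 … F95) -/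
lemma elim5 (hL : PropL7c) {N a b c a' b' c' : ℕ} (S : Setting N (a, b, c) (a', b', c'))
    (h5N : 5 ∣ N) (ha : 5 ∣ a) : False := by
  have hb : ¬ 5 ∣ b := fun hb => noZ3 S Nat.prime_five h5N ha hb (dvd_third h5N S.hsum ha hb)
  have hc : ¬ 5 ∣ c := fun hc => noZ3 S Nat.prime_five h5N ha (dvd_second h5N S.hsum ha hc) hc
  have hodd := S.odd
  have h3N := S.three
  obtain ⟨n, rfl⟩ := h5N
  by_cases hn20 : n ≤ 20
  · exact small5 S hn20
  have hn : 20 < n := by omega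
  have hnN : n ∣ 5 * n := dvd_mul_left n 5
  have h5n : ¬ 5 ∣ n := not_dvd_cofactor Nat.prime_five S.sq
  have h2n : ¬ 2 ∣ n := fun h => S.two (Dvd.dvd.mul_left h 5)
  have h3n : ¬ 3 ∣ n := fun h => h3N (Dvd.dvd.mul_left h 5)
  have hn30 : Nat.Coprime n 30 := coprime30 h2n h3n h5n
  have hco : Nat.Coprime a n := coprime_of hL S hnN h5n
  by_cases ha' : 5 ∣ a'
  · have hb' : ¬ 5 ∣ b' := fun h => noZ3 S.symm Nat.prime_five (dvd_mul_right 5 n) ha' h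
      (dvd_third (dvd_mul_right 5 n) S.hsum' ha' h)
    have hc' : ¬ 5 ∣ c' := fun h => noZ3 S.symm Nat.prime_five (dvd_mul_right 5 n) ha'
      (dvd_second (dvd_mul_right 5 n) S.hsum' ha' h) h
    have hco' : Nat.Coprime a' n := coprime_of hL S.symm hnN h5n
    exact PropZ5.propZ5 n a b c a' b' c' hn hn30 S.hsum ha hco hb hc S.hsum' ha' hco' hb' hc'
      S.disj.1.1 S.same
  · by_cases hb' : 5 ∣ b'
    · have hc' : ¬ 5 ∣ c' := fun h => ha' (dvd_first (dvd_mul_right 5 n) S.hsum' hb' h)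
      have S₂ := S.swap12'
      have hco' : Nat.Coprime b' n := coprime_of hL S₂.symm hnN h5n
      exact PropZ5.propZ5 n a b c b' a' c' hn hn30 S₂.hsum ha hco hb hc S₂.hsum' hb' hco' ha' hc'
        S₂.disj.1.1 S₂.same
    · by_cases hc' : 5 ∣ c'
      · have S₃ := S.rot'
        have hco' : Nat.Coprime c' n := coprime_of hL S₃.symm hnN h5n
        exact PropZ5.propZ5 n a b c c' a' b' hn hn30 S₃.hsum ha hco hb hc S₃.hsum' hc' hco' ha' hb'
          S₃.disj.1.1 S₃.same
      · exact PropL5.propL5 n a b c a' b' c' hn h5n S.hsum ha hco hb hc S.hsum' ha' hb' hc' S.same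

/-! ## THEOREM D6 -/

/-- a prime of the level dividing the first entry of the first triple is impossible -/
lemma elim (hL : PropL7c) {N a b c a' b' c' : ℕ} (S : Setting N (a, b, c) (a', b', c'))
    (h : ¬ Nat.Coprime a N) : False := by
  obtain ⟨q, hq, hqa, hqN⟩ := Nat.Prime.not_coprime_iff_dvd.mp h
  by_cases hq5 : q = 5
  · subst hq5
    exact elim5 hL S hqN hqa
  · exact elim_ge7 hL S hq (seven_le_prime hq hqN S.odd S.three hq5) hqN hqa

/-- THEOREM D6, jointly primitive case: the setting is contradictory (given PROPOSITION L7(c) and THEOREM U). -/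
theorem d6_primitive (hL : PropL7c) (hU : ThmU) {N a b c a' b' c' : ℕ}
    (S : Setting N (a, b, c) (a', b', c')) : False := by
  by_cases hunits : Nat.Coprime a N ∧ Nat.Coprime b N ∧ Nat.Coprime c N ∧
      Nat.Coprime a' N ∧ Nat.Coprime b' N ∧ Nat.Coprime c' N
  · obtain ⟨h1, h2, h3, h4, h5, h6⟩ := hunits
    rcases hU N a b c a' b' c' S.sq S.two S.three S.hsum S.hsum' h1 h2 h3 h4 h5 h6 S.same with h | h | h
    · exact S.disj.1.1 h
    · exact S.disj.1.2.1 h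
    · exact S.disj.1.2.2 h
  · simp only [not_and_or] at hunits
    rcases hunits with h | h | h | h | h | h
    · exact elim hL S h
    · exact elim hL S.swap12 h
    · exact elim hL S.rot h
    · exact elim hL S.symm h
    · exact elim hL S.symm.swap12 h
    · exact elim hL S.symm.rot h

/-- THEOREM D6 (`tables/KR-FREE.md` §7) from PROPOSITION L7(c) and THEOREM U: at a squarefree level prime
to 6 there is no disjoint coincidence.  The common divisor of the level and the six entries is divided out
by strong induction on the level (`sameType_descend`), then `d6_primitive` applies. -/
theorem theoremD6_of (hL : PropL7c) (hU : ThmU) : D6 := by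
  intro N
  refine Nat.strong_induction_on
    (p := fun N => ∀ a b c a' b' c' : ℕ, Squarefree N → ¬ 2 ∣ N → ¬ 3 ∣ N →
      N ∣ a + b + c → N ∣ a' + b' + c' →
      ¬ N ∣ a → ¬ N ∣ b → ¬ N ∣ c → ¬ N ∣ a' → ¬ N ∣ b' → ¬ N ∣ c' →
      Disj N (a, b, c) (a', b', c') → SameType N (a, b, c) (a', b', c') → False) N ?_
  intro N ih a b c a' b' c' hsq h2 h3 hs hs' ha hb hc ha' hb' hc' hd hH
  by_cases hjp : JP N (a, b, c) (a', b', c')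
  · exact d6_primitive hL hU ⟨hsq, h2, h3, hs, hs', ha, hb, hc, ha', hb', hc', hjp, hd, hH⟩
  · -- a prime `q` divides the level and all six entries: descend to level `N / q`
    simp only [JP, not_forall, not_false_eq_true, and_true, exists_prop] at hjp
    obtain ⟨q, hq, hqN, h1, h2', h3', h4, h5, h6⟩ := hjp
    have hN0 : 0 < N := Nat.pos_of_ne_zero (fun h => by subst h; exact not_squarefree_zero hsq)
    obtain ⟨N₁, rfl⟩ := hqN
    obtain ⟨a₁, rfl⟩ := h1
    obtain ⟨b₁, rfl⟩ := h2'
    obtain ⟨c₁, rfl⟩ := h3'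
    obtain ⟨a₁', rfl⟩ := h4
    obtain ⟨b₁', rfl⟩ := h5
    obtain ⟨c₁', rfl⟩ := h6
    have hN₁ : 0 < N₁ := pos_right hN0
    have hlt : N₁ < q * N₁ := by
      have h2q := hq.two_le
      nlinarith
    refine ih N₁ hlt a₁ b₁ c₁ a₁' b₁' c₁' (Squarefree.squarefree_of_dvd (dvd_mul_left N₁ q) hsq)
      (fun h => h2 (Dvd.dvd.mul_left h q)) (fun h => h3 (Dvd.dvd.mul_left h q)) ?_ ?_
      (fun h => ha (Nat.mul_dvd_mul_left q h)) (fun h => hb (Nat.mul_dvd_mul_left q h))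
      (fun h => hc (Nat.mul_dvd_mul_left q h)) (fun h => ha' (Nat.mul_dvd_mul_left q h))
      (fun h => hb' (Nat.mul_dvd_mul_left q h)) (fun h => hc' (Nat.mul_dvd_mul_left q h))
      (disj_descend hd) (sameType_descend hq.pos hN₁ hH)
    · have h' : q * a₁ + q * b₁ + q * c₁ = q * (a₁ + b₁ + c₁) := by ring
      rw [h'] at hs
      exact Nat.dvd_of_mul_dvd_mul_left hq.pos hs
    · have h' : q * a₁' + q * b₁' + q * c₁' = q * (a₁' + b₁' + c₁') := by ring
      rw [h'] at hs'
      exact Nat.dvd_of_mul_dvd_mul_left hq.pos hs'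

/-! ## Kernel sanity checks of the definitions -/

/-- `Disj` computes: `(1, 2, 32)` and `(3, 4, 28)` are disjoint mod `35`, `(1, 2, 32)` and `(36, 4, 30)` are not -/
example : Disj 35 (1, 2, 32) (3, 4, 28) := by unfold Disj NotIn; decide
example : ¬ Disj 35 (1, 2, 32) (36, 4, 30) := by unfold Disj NotIn; decide

/-- `JP` at a concrete pair: `(7, 1, 27)` and `(5, 10, 20)` are jointly primitive at level `35`
(the only primes of `35` are `5`, `7`; `5 ∤ 7` and `7 ∤ 5`) -/
example : JP 35 (7, 1, 27) (5, 10, 20) := by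
  intro q hq hq35 h1 _ _ h4 _ _
  have h := Nat.dvd_gcd h1 h4
  have : q ∣ 1 := by simpa using h
  exact hq.one_lt.ne' (Nat.dvd_one.mp this)

end HodgeFermat.KRFree.TheoremD6
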